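import Summits.BirchSwinnertonDyer.BirchSwinnertonDyer.Theorems.KolyvaginDepthDoorDepthTableRowKitSecondSign
import Summits.BirchSwinnertonDyer.BirchSwinnertonDyer.Theorems.KolyvaginDepthDoorDepthTableGlobalMinimal
import Summits.BirchSwinnertonDyer.BirchSwinnertonDyer.Theorems.KolyvaginDepthDoorDepthTableOddPrimeKit
import Summits.BirchSwinnertonDyer.BirchSwinnertonDyer.Theorems.Rank2ObservatoryKernelPrimes
import Summits.BirchSwinnertonDyer.BirchSwinnertonDyer.Theorems.Rank1ResidualIntModelReduction
import Summits.BirchSwinnertonDyer.Rank1Residual.Additive.PointCountEulerNat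
import Literature.NumberTheory.EllipticCurves.ComplexMultiplicationNotSemistable
import Literature.NumberTheory.EllipticCurves.RationalPointInfiniteOrderCriteria
import Mathlib.Tactic.NormNum.LegendreSymbol
import HarnessLib

/-!
# Route `KolyvaginDepthDoor` — DEPTH-TABLE ROWS ON THE SECOND SIGN, part 10: `131a1` `(5, -71, 269)`, `131a1` `(7, -155, 251)`
# (crux `KolyvaginDepthSupply`, stmt-BirchSwinnertonDyer-21765)

Helper file (`--supports stmt-BirchSwinnertonDyer-21765 --as helper`); it closes nothing and BSD is
not proved by it. Same design as part 1 (`…DepthTableRowsSecondSign1`, which see for the full account):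
a RANK-ONE curve `E`, a Heegner field `K = ℚ(√D)` for `N_E` whose twist `E^{(D)}` has two independent
rational points certified IN THE KERNEL (`Rank2Observatory.two_le_mordellWeilRank_of_ratCert` on the
twist model `[0, D b₂, 0, 8D²b₄, 16D³b₆]` of the kit `…RowKitSecondSign`), every other side condition
(global minimality, non-CM, `ρ̄_{E,p^m}` onto ∀ `m`, `p` good ordinary, Heegner condition, Kolyvagin prime,
`1 ≤ rank_ℤ E(ℚ)`) a kernel theorem; each row `SecondSign.C<label>.depthRow_<p>_neg<|D|>_<ℓ>_secondSign`
concludes from the bit `c_1(ℓ) ≠ 0` at ANY datum, granted (γ) = `GrossLMS1991.prop37_2_frobeniusCongruence`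
only: `corank Ш(E)[p^∞] = 0`, `rank E = 1`, `corank Ш(E^{(D)})[p^∞] = 0`, `rank E^{(D)} = 2`,
`E(ℚ)[p] = 0`, `Ш(E)[p] = 0`, `#Sel_p(E) = p`, `Ш(E^{(D)})[p] = 0`, `#Sel_p(E^{(D)}) = p²`. CONDITIONAL on
(γ) and the bit; per-curve; BSD is not proved by it.

| curve | `Δ` | `p` (`a_p`) | `d_K` | `ℓ` (`a_ℓ`) | twist model | `P₁`, `P₂` on the twist model |
|---|---|---|---|---|---|---|
| `131a1` = `[0,-1,1,1,0]` | `-131` | `5` (`-2`) | `-71` | `269` (`25`) | `[0,284,0,80656,-5726576]` | `(1349, -55451)`, `(232312/729, -177342380/19683)` |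
| `131a1` = `[0,-1,1,1,0]` | `-131` | `7` (`-1`) | `-155` | `251` (`-28`) | `[0,620,0,384400,-59582000]` | `(1860, -96100)`, `(206460/49, -101385500/343)` |

References: [Kolyvagin1991MathAnn] Thm. 2.3; [GrossLMS1991] Prop. 3.7 (2), §5 (5.1), Prop. 6.2 (1);
[McCallumLMS1991] §§2–5; [Serre1972] §5.4 Prop. 21; [Mazur1978] §6 Prop. 6.3 (1); [CremonaAlgorithms1997]
Table 1, §2.4, §3.5; [SilvermanAEC2009] III.2.3, VII.3.1(b), VII.3.4, VIII.6.7, X.5 Cor. 5.4;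
[Marcus1977] Ch. 3 Thm. 25; [JetchevLauterStein2009] §3.6 (arXiv:0707.0032).
-/

set_option linter.dupNamespace false

noncomputable section

open scoped Classical NumberField

namespace Summit.BirchSwinnertonDyer.BirchSwinnertonDyer.Theorems.KolyvaginDepthDoor

open Literature.NumberTheory.EllipticCurves Literature.NumberTheory.EllipticCurves.ModularForms
  WeierstrassCurve
open Summit.BirchSwinnertonDyer.BirchSwinnertonDyer.Rank2Observatory
open Summit.BirchSwinnertonDyer.BirchSwinnertonDyer.Rank1Residual
open Summit.BirchSwinnertonDyer.Rank1Residual.Additive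

namespace SecondSign

/-! ## Curve `131a1` = `[0,-1,1,1,0]` (`Δ = -131`), rank one -/

namespace C131a1

/-- `131a1` = `[0,-1,1,1,0]` is an elliptic curve over `ℚ` (`Δ = -131 ≠ 0`, kernel-checked).
[cite: CremonaAlgorithms1997, Table 1 (131a1)] -/
theorem isElliptic : ((⟨0, -1, 1, 1, 0⟩ : WeierstrassCurve ℤ).map (Int.castRingHom ℚ)).IsElliptic := by
  rw [WeierstrassCurve.isElliptic_iff, WeierstrassCurve.map_Δ, isUnit_iff_ne_zero, eq_intCast,
    Int.cast_ne_zero]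
  decide +kernel

/-- **`131a1` = `[0,-1,1,1,0]` is a global minimal equation over `ℚ`** (`|Δ| = 131 < 3¹²`, `2¹² ∤ Δ`;
`isGloballyMinimal_map_int_of_natAbs_Δ_lt`, kernel-checked). [cite: CremonaAlgorithms1997, Table 1 (131a1)]
[cite: SilvermanAEC2009, VII.1 Remark 1.1 and VIII.8] -/
theorem isGloballyMinimal : ((⟨0, -1, 1, 1, 0⟩ : WeierstrassCurve ℤ).map (Int.castRingHom ℚ)).IsGloballyMinimal :=
  isGloballyMinimal_map_int_of_natAbs_Δ_lt _ (by decide +kernel) (by decide +kernel) (by decide +kernel)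

/-- The integral model of `131a1` is `[0,-1,1,1,0]`. [cite: CremonaAlgorithms1997, Table 1 (131a1)] -/
theorem intModel :
    haveI := isGloballyMinimal;
    integralModelInt ((⟨0, -1, 1, 1, 0⟩ : WeierstrassCurve ℤ).map (Int.castRingHom ℚ)) = ⟨0, -1, 1, 1, 0⟩ := by
  haveI := isGloballyMinimal
  exact IntModel.integralModelInt_eq_of_map_eq _ rfl

/-- `#Ẽ(𝔽_3) = 5`, `a_3 = -1` for `131a1`, kernel-decided (`ℕ`-arithmetic Euler count
`PointCountNat.natCard_point_map_eq`). [cite: CremonaAlgorithms1997, Table 1 (131a1) and §2.4] -/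
theorem card_3 :
    Nat.card (((⟨0, -1, 1, 1, 0⟩ : WeierstrassCurve ℤ).map (Int.castRingHom (ZMod 3))).toAffine.Point) = 5 := by
  rw [PointCountNat.natCard_point_map_eq (hℓ := ⟨by norm_num⟩) (by norm_num) 0 (-1) 1 1 0
    (by decide +kernel)]
  decide +kernel

/-- `#Ẽ(𝔽_5) = 8`, `a_5 = -2` for `131a1`, kernel-decided (`ℕ`-arithmetic Euler count
`PointCountNat.natCard_point_map_eq`). [cite: CremonaAlgorithms1997, Table 1 (131a1) and §2.4] -/
theorem card_5 :
    Nat.card (((⟨0, -1, 1, 1, 0⟩ : WeierstrassCurve ℤ).map (Int.castRingHom (ZMod 5))).toAffine.Point) = 8 := by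
  rw [PointCountNat.natCard_point_map_eq (hℓ := ⟨by norm_num⟩) (by norm_num) 0 (-1) 1 1 0
    (by decide +kernel)]
  decide +kernel

/-- `#Ẽ(𝔽_7) = 9`, `a_7 = -1` for `131a1`, kernel-decided (`ℕ`-arithmetic Euler count
`PointCountNat.natCard_point_map_eq`). [cite: CremonaAlgorithms1997, Table 1 (131a1) and §2.4] -/
theorem card_7 :
    Nat.card (((⟨0, -1, 1, 1, 0⟩ : WeierstrassCurve ℤ).map (Int.castRingHom (ZMod 7))).toAffine.Point) = 9 := by
  rw [PointCountNat.natCard_point_map_eq (hℓ := ⟨by norm_num⟩) (by norm_num) 0 (-1) 1 1 0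
    (by decide +kernel)]
  decide +kernel

/-- `#Ẽ(𝔽_251) = 280`, `a_251 = -28` for `131a1`, kernel-decided (`ℕ`-arithmetic Euler count
`PointCountNat.natCard_point_map_eq`). [cite: CremonaAlgorithms1997, Table 1 (131a1) and §2.4] -/
theorem card_251 :
    Nat.card (((⟨0, -1, 1, 1, 0⟩ : WeierstrassCurve ℤ).map (Int.castRingHom (ZMod 251))).toAffine.Point) = 280 := by
  rw [PointCountNat.natCard_point_map_eq (hℓ := ⟨by norm_num⟩) (by norm_num) 0 (-1) 1 1 0
    (by decide +kernel)]
  decide +kernel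

/-- `#Ẽ(𝔽_269) = 245`, `a_269 = 25` for `131a1`, kernel-decided (`ℕ`-arithmetic Euler count
`PointCountNat.natCard_point_map_eq`). [cite: CremonaAlgorithms1997, Table 1 (131a1) and §2.4] -/
theorem card_269 :
    Nat.card (((⟨0, -1, 1, 1, 0⟩ : WeierstrassCurve ℤ).map (Int.castRingHom (ZMod 269))).toAffine.Point) = 245 := by
  rw [PointCountNat.natCard_point_map_eq (hℓ := ⟨by norm_num⟩) (by norm_num) 0 (-1) 1 1 0
    (by decide +kernel)]
  decide +kernel

/-- **`5 ∈ B(131a1)`: `ρ̄_{E,5^m}` is onto for every `m`** (unconditional): semistable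
(`gcd(c₄, Δ) = 1`), `X² − a_7 X + 7` with `a_7 = -1` root-free mod `5` (`E[5]` irreducible, Mazur
6.3; onto, Serre Prop. 21), and the multiplicative prime `131` with `131^1 ∥ Δ`, `5 ∤ 1` (a transvection
lifts the image to `GL₂(ℤ/5^m)`; `hasSurjectiveModNGaloisRep_pow_of_intModel_certificate`).
[cite: Serre1972, §5.4 Prop. 21] [cite: Mazur1978, §6 Prop. 6.3 (1)] [cite: SerreAbelianLadic1968, Ch. IV §3.4] -/
theorem hasSurjectiveModNGaloisRep_pow_5 (m : ℕ) :
    ((⟨0, -1, 1, 1, 0⟩ : WeierstrassCurve ℤ).map (Int.castRingHom ℚ)).HasSurjectiveModNGaloisRep (5 ^ m : ℕ) := by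
  have hn : ∀ t : ZMod 5, t ^ 2 - (((7 : ℕ) : ℤ) + 1 - (9 : ℕ) : ℤ) * t + ((7 : ℕ) : ZMod 5) ≠ 0 := by
    decide +kernel
  haveI := Fact.mk (by norm_num : Nat.Prime 5)
  haveI := Fact.mk (by norm_num : Nat.Prime 7)
  haveI := isElliptic
  haveI := isGloballyMinimal
  exact hasSurjectiveModNGaloisRep_pow_of_intModel_certificate intModel
    (by rw [Int.isCoprime_iff_gcd_eq_one]; decide +kernel) 5 7 (by norm_num) (by decide +kernel)
    (n := 9) card_7 hn 131 (by norm_num) (by norm_num) (by decide +kernel) (by decide +kernel)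
    (e := 1) (by decide +kernel) (by decide +kernel) (by decide +kernel) m

/-- **`5` is a prime of good ordinary reduction for `131a1`** (`5 ∤ Δ`, `a_5 = -2`) — the crux's
conditions on the witness prime. [cite: CremonaAlgorithms1997, Table 1 (131a1)] -/
theorem goodOrdinary_5 :
    haveI := Fact.mk (by norm_num : Nat.Prime 5);
    haveI := isGloballyMinimal;
    ((⟨0, -1, 1, 1, 0⟩ : WeierstrassCurve ℤ).map (Int.castRingHom ℚ)).HasGoodReductionAtPrime 5 ∧ ¬ ((5 : ℕ) : ℤ) ∣ ((⟨0, -1, 1, 1, 0⟩ : WeierstrassCurve ℤ).map (Int.castRingHom ℚ)).frobeniusTrace 5 := by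
  haveI := Fact.mk (by norm_num : Nat.Prime 5)
  haveI := isGloballyMinimal
  exact goodOrdinary_of_intModel_certificate intModel 5 (by decide +kernel) (n := 8) card_5
    (by decide +kernel)

/-- **`7 ∈ B(131a1)`: `ρ̄_{E,7^m}` is onto for every `m`** (unconditional): semistable
(`gcd(c₄, Δ) = 1`), `X² − a_3 X + 3` with `a_3 = -1` root-free mod `7` (`E[7]` irreducible, Mazur
6.3; onto, Serre Prop. 21), and the multiplicative prime `131` with `131^1 ∥ Δ`, `7 ∤ 1` (a transvection
lifts the image to `GL₂(ℤ/7^m)`; `hasSurjectiveModNGaloisRep_pow_of_intModel_certificate`).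
[cite: Serre1972, §5.4 Prop. 21] [cite: Mazur1978, §6 Prop. 6.3 (1)] [cite: SerreAbelianLadic1968, Ch. IV §3.4] -/
theorem hasSurjectiveModNGaloisRep_pow_7 (m : ℕ) :
    ((⟨0, -1, 1, 1, 0⟩ : WeierstrassCurve ℤ).map (Int.castRingHom ℚ)).HasSurjectiveModNGaloisRep (7 ^ m : ℕ) := by
  have hn : ∀ t : ZMod 7, t ^ 2 - (((3 : ℕ) : ℤ) + 1 - (5 : ℕ) : ℤ) * t + ((3 : ℕ) : ZMod 7) ≠ 0 := by
    decide +kernel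
  haveI := Fact.mk (by norm_num : Nat.Prime 7)
  haveI := Fact.mk (by norm_num : Nat.Prime 3)
  haveI := isElliptic
  haveI := isGloballyMinimal
  exact hasSurjectiveModNGaloisRep_pow_of_intModel_certificate intModel
    (by rw [Int.isCoprime_iff_gcd_eq_one]; decide +kernel) 7 3 (by norm_num) (by decide +kernel)
    (n := 5) card_3 hn 131 (by norm_num) (by norm_num) (by decide +kernel) (by decide +kernel)
    (e := 1) (by decide +kernel) (by decide +kernel) (by decide +kernel) m

/-- **`7` is a prime of good ordinary reduction for `131a1`** (`7 ∤ Δ`, `a_7 = -1`) — the crux's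
conditions on the witness prime. [cite: CremonaAlgorithms1997, Table 1 (131a1)] -/
theorem goodOrdinary_7 :
    haveI := Fact.mk (by norm_num : Nat.Prime 7);
    haveI := isGloballyMinimal;
    ((⟨0, -1, 1, 1, 0⟩ : WeierstrassCurve ℤ).map (Int.castRingHom ℚ)).HasGoodReductionAtPrime 7 ∧ ¬ ((7 : ℕ) : ℤ) ∣ ((⟨0, -1, 1, 1, 0⟩ : WeierstrassCurve ℤ).map (Int.castRingHom ℚ)).frobeniusTrace 7 := by
  haveI := Fact.mk (by norm_num : Nat.Prime 7)
  haveI := isGloballyMinimal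
  exact goodOrdinary_of_intModel_certificate intModel 7 (by decide +kernel) (n := 9) card_7
    (by decide +kernel)

/-- **`131a1` is not CM** (unconditional): multiplicative reduction at `131` (`131 ∣ Δ = -131`,
`131 ∤ c₄ = -32`), while a CM curve over `ℚ` has no multiplicative prime (integral `j`).
[cite: SilvermanATAEC1994, Thm. II.6.4 (PDF p. 148)] [cite: CremonaAlgorithms1997, Table 1 (131a1)] -/
theorem not_hasCM :
    haveI := isElliptic;
    ¬ ((⟨0, -1, 1, 1, 0⟩ : WeierstrassCurve ℤ).map (Int.castRingHom ℚ)).HasCM := by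
  haveI := isElliptic
  haveI := isGloballyMinimal
  haveI := Fact.mk (by norm_num : Nat.Prime 131)
  intro hCM
  exact not_hasMultiplicativeReductionAtPrime_of_hasCM _ hCM 131
    (IntModel.hasMultiplicativeReductionAtPrime_of_intModel intModel 131 (by decide +kernel)
      (by decide +kernel))

/-- **`1 ≤ rank_ℤ E(ℚ)` for `131a1` IN THE KERNEL** — kind-`NL` certificate: the rational point
`4·(0, 0) = (6/25, -146/125)` has `5 ∣ den(x)`, hence infinite order (AEC VII.3.4; tree
`one_le_mordellWeilRank_of_dvd_den`). [cite: SilvermanAEC2009, VII.3.4 and Thm. VIII.6.7]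
[cite: CremonaAlgorithms1997, Table 1 (131a1)] -/
theorem one_le_rank : 1 ≤ ((⟨0, -1, 1, 1, 0⟩ : WeierstrassCurve ℤ).map (Int.castRingHom ℚ)).mordellWeilRank := by
  haveI := isElliptic
  haveI := isGloballyMinimal
  haveI : Fact (Nat.Prime 5) := ⟨by norm_num⟩
  have hP : ((⟨0, -1, 1, 1, 0⟩ : WeierstrassCurve ℤ).map (Int.castRingHom ℚ)).toAffine.Nonsingular ((6 : ℚ) / 25) ((-146 : ℚ) / 125) :=
    WeierstrassCurve.Affine.equation_iff_nonsingular.mp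
      ((WeierstrassCurve.Affine.equation_iff _ _).mpr (by norm_num [WeierstrassCurve.map]))
  exact one_le_mordellWeilRank_of_dvd_den _ 5 (by norm_num) hP (by decide +kernel)


/-! ### Row `131a1`, `(p, d_K, ℓ) = (5, -71, 269)`: the twist `E^{(-71)}` has rank two -/

/-- **Heegner data `d_K = -71` for `131a1`**: every prime of `Δ = -131` (hence of `N_E`) splits in a
quadratic field of discriminant `-71` (Kronecker symbols `= 1`). [cite: Marcus1977, Ch. 3 Thm. 25]
[cite: GrossLMS1991, §1] -/
theorem heegner_neg71 : ∀ q : ℕ, q.Prime → (q : ℤ) ∣ (⟨0, -1, 1, 1, 0⟩ : WeierstrassCurve ℤ).Δ →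
    (q = 2 → (-71 : ℤ) % 8 = 1) ∧ (q ≠ 2 → jacobiSym (-71) q = 1) :=
  forall_prime_dvd_of_natAbs_eq_pow (a := 131) (i := 1) (by decide +kernel) (by norm_num)
    ⟨by norm_num, by norm_num⟩

/-- The twist model of the kit `…RowKitSecondSign` for `(131a1, D = -71)`:
`[0, D b₂, 0, 8 D² b₄, 16 D³ b₆] = ⟨0, 284, 0, 80656, -5726576⟩` (`ℚ`-isomorphic to `E^{(-71)}`, `u = 1/2`).
[cite: SilvermanAEC2009, X.5 Cor. 5.4] -/
theorem twistModel_neg71 :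
    (⟨0, (-71) * (⟨0, -1, 1, 1, 0⟩ : WeierstrassCurve ℤ).b₂, 0, 8 * (-71) ^ 2 * (⟨0, -1, 1, 1, 0⟩ : WeierstrassCurve ℤ).b₄, 16 * (-71) ^ 3 * (⟨0, -1, 1, 1, 0⟩ : WeierstrassCurve ℤ).b₆⟩ : WeierstrassCurve ℤ) =
      ⟨0, 284, 0, 80656, -5726576⟩ := by
  ext <;> decide +kernel

/-- Killers for the twist model `⟨0, 284, 0, 80656, -5726576⟩` of `E^{(-71)}` from the kernel counts
`(q, #Ṽ(𝔽_q)) ∈ [(3, 5), (7, 7)]`. [cite: SilvermanAEC2009, Prop. VII.3.1(b)] -/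
theorem killers_neg71 : ∀ ℓN ∈ [((3 : ℕ), (5 : ℕ)), (7, 7)], ℓN.1.Prime ∧
    ∀ (x : ((⟨0, 284, 0, 80656, -5726576⟩ : WeierstrassCurve ℤ).map (Int.castRingHom ℚ)).toAffine.Point)
      (n : ℕ), ¬ ℓN.1 ∣ n → n • x = 0 → ℓN.2 • x = 0 :=
  killers_cons _ (q := 3) (N := 5) (by decide +kernel) (by decide +kernel)
    (killers_cons _ (q := 7) (N := 7) (by decide +kernel) (by decide +kernel)
    (killers_nil _))

/-- **`2 ≤ rank_ℤ E^{(-71)}(ℚ)` for `E = 131a1` IN THE KERNEL**, on the twist model `⟨0, 284, 0, 80656, -5726576⟩`: rational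
kernel certificate `Rank2Observatory.two_le_mordellWeilRank_of_ratCert` with the points
`P₁ = (1349, -55451)`, `P₂ = (232312/729, -177342380/19683)` (found by a naive search on `d·η² = f(x)`), their chord
`P₁ + P₂ = (80, -1748)`, odd torsion annihilator `t = 1` from the counts at `q = 3, 7`, and doubling
witnesses at `q = 5, 5, 5` (residues `(4,4)`, `(3,0)`, `(0,2)`). Hence `P₁, P₂` are
`ℤ`-independent. [cite: SilvermanAEC2009, III.2.3, Prop. VII.3.1(b) and Thm. VIII.6.7]
[cite: CremonaAlgorithms1997, §3.5] -/
theorem two_le_rank_twist_neg71 :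
    2 ≤ ((⟨0, 284, 0, 80656, -5726576⟩ : WeierstrassCurve ℤ).map (Int.castRingHom ℚ)).mordellWeilRank :=
  two_le_mordellWeilRank_of_ratCert _ (x₁ := 1349) (y₁ := -55451) (x₂ := 232312/729) (y₂ := -177342380/19683)
    (x₃ := 80) (y₃ := -1748) (by decide +kernel) (by decide +kernel)
    (by decide +kernel) (by decide +kernel) (t := 1) (by decide) killers_neg71 (by decide +kernel)
    5 5 5 (by decide +kernel) (by decide +kernel) (by decide +kernel) (by decide +kernel)
    (by decide +kernel) (by decide +kernel) 4 4 3 0 0 2 (by decide +kernel)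
    (by decide +kernel) (by decide +kernel) (by decide +kernel) (by decide +kernel)
    (by decide +kernel)

/-- **SECOND-SIGN DEPTH-TABLE ROW `131a1`, `(p, d_K, ℓ) = (5, -71, 269)`, ON PRINT-STANDARD INPUTS.**
For `E = 131a1` (rank one), ANY imaginary quadratic `K` with `d_K = -71` (Heegner for `N_E`; the twist
`E^{(-71)}` has two independent rational points, certified in the kernel), any frame `(Dt, β, ι)` and
ANY single Kolyvagin–Heegner datum `d` of conductor `269` (a Kolyvagin prime: `(-71/269) = −1`,
`5 ∣ 269 + 1`, `5 ∣ a_269 = 25`), granted the ONE Literature fact (γ) =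
`GrossLMS1991.prop37_2_frobeniusCongruence` (Gross 1991 Prop. 3.7 (2); cite-only): IF
`d.kolyvaginClass _ 1 ≠ 0` (the row's bit), THEN `corank_{ℤ_5} Ш(E)[5^∞] = 0`, `rank_ℤ E(ℚ) = 1`,
`corank_{ℤ_5} Ш(E^{(-71)})[5^∞] = 0`, `rank_ℤ E^{(-71)}(ℚ) = 2`, `E(ℚ)[5] = 0`, `Ш(E/ℚ)[5] = 0`,
`#Sel^(5)(E/ℚ) = 5`, `Ш(E^{(-71)}/ℚ)[5] = 0` and `#Sel^(5)(E^{(-71)}/ℚ) = 5²` — the crux's SECOND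
rank clause `ν = rank E(ℚ) = rank E^{(d_K)}(ℚ) − 1` at this curve, and `Ш[5] = 0` for the RANK-TWO
curve `E^{(-71)}` (conductor `N_E·71²`), which no first-sign row reaches through `K`. Side conditions:
`ρ̄_{E,5^m}` onto (`hasSurjectiveModNGaloisRep_pow_5`), non-CM, Heegner, Kolyvagin prime
(`card_269`), (KN_5) from `Δ(E₀) = -131` (`decide`-able table), `1 ≤ rank` (`one_le_rank`),
`2 ≤ rank E^{(-71)}` (`two_le_rank_twist_neg71`) — all kernel theorems. CONDITIONAL on (γ) and the
bit; per-curve; BSD is not proved by it. [cite: Kolyvagin1991MathAnn, Thm. 2.3]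
[cite: GrossLMS1991, Prop. 3.7 (2), §5 (5.1), Prop. 6.2 (1)] [cite: McCallumLMS1991, §§2–5]
[cite: JetchevLauterStein2009, §3.6 (arXiv:0707.0032)] -/
theorem depthRow_5_neg71_269_secondSign
    (h372 : GrossLMS1991.prop37_2_frobeniusCongruence)
    (K : Type) [Field K] [NumberField K] (hK : IsImaginaryQuadratic K)
    (hD : NumberField.discr K = -71) :
    haveI := isElliptic;
    haveI := isGloballyMinimal;
    haveI : NeZero (((⟨0, -1, 1, 1, 0⟩ : WeierstrassCurve ℤ).map (Int.castRingHom ℚ)).conductorNorm ℤ) := neZero_conductorNorm_of_isElliptic _;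
    ∀ (Dt : ModularParametrizationData ((⟨0, -1, 1, 1, 0⟩ : WeierstrassCurve ℤ).map (Int.castRingHom ℚ)) (((⟨0, -1, 1, 1, 0⟩ : WeierstrassCurve ℤ).map (Int.castRingHom ℚ)).conductorNorm ℤ)) (β : ℤ) (ι : K →+* ℂ)
      (d : KolyvaginHeegnerData Dt β ι 269),
    d.kolyvaginClass (p := 5) (by norm_num) 1 ≠ 0 →
    ((⟨0, -1, 1, 1, 0⟩ : WeierstrassCurve ℤ).map (Int.castRingHom ℚ)).shaCorank 5 = 0 ∧ ((⟨0, -1, 1, 1, 0⟩ : WeierstrassCurve ℤ).map (Int.castRingHom ℚ)).mordellWeilRank = 1 ∧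
      (((⟨0, -1, 1, 1, 0⟩ : WeierstrassCurve ℤ).map (Int.castRingHom ℚ)).quadraticTwist ((-71 : ℤ) : ℚ)).shaCorank 5 = 0 ∧
      (((⟨0, -1, 1, 1, 0⟩ : WeierstrassCurve ℤ).map (Int.castRingHom ℚ)).quadraticTwist ((-71 : ℤ) : ℚ)).mordellWeilRank = 2 ∧
      (∀ P : ((⟨0, -1, 1, 1, 0⟩ : WeierstrassCurve ℤ).map (Int.castRingHom ℚ)).toAffine.Point, 5 • P = 0 → P = 0) ∧
      (∀ x ∈ ((⟨0, -1, 1, 1, 0⟩ : WeierstrassCurve ℤ).map (Int.castRingHom ℚ)).sha, 5 • x = 0 → x = 0) ∧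
      Nat.card ↥(selmerGroup ((⟨0, -1, 1, 1, 0⟩ : WeierstrassCurve ℤ).map (Int.castRingHom ℚ)) ((5 : ℕ) : ℤ)) = 5 ∧
      (∀ x ∈ (((⟨0, -1, 1, 1, 0⟩ : WeierstrassCurve ℤ).map (Int.castRingHom ℚ)).quadraticTwist ((-71 : ℤ) : ℚ)).sha, 5 • x = 0 → x = 0) ∧
      Nat.card ↥(selmerGroup (((⟨0, -1, 1, 1, 0⟩ : WeierstrassCurve ℤ).map (Int.castRingHom ℚ)).quadraticTwist ((-71 : ℤ) : ℚ)) ((5 : ℕ) : ℤ)) = 5 ^ 2 := by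
  haveI := isElliptic
  haveI := isGloballyMinimal
  haveI : NeZero (((⟨0, -1, 1, 1, 0⟩ : WeierstrassCurve ℤ).map (Int.castRingHom ℚ)).conductorNorm ℤ) := neZero_conductorNorm_of_isElliptic _
  intro Dt β ι d hne
  haveI := Fact.mk (by norm_num : Nat.Prime 5)
  exact depthRowSecondSign_print_of_datum_of_intModel_certificate intModel h372 not_hasCM one_le_rank
    5 (by norm_num) hasSurjectiveModNGaloisRep_pow_5 K hK hD (by norm_num) (by norm_num)
    twistModel_neg71 two_le_rank_twist_neg71 heegner_neg71 269 (by norm_num) (by norm_num)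
    (by decide +kernel) (by norm_num) (by norm_num) (by norm_num) (by norm_num) (n := 245) card_269
    (by norm_num) (Δ₀ := -131) (by decide +kernel) (B := 11) (by decide +kernel) (by decide +kernel)
    (fun _ _ ↦ Or.inl (by norm_num)) Dt β ι d hne


/-! ### Row `131a1`, `(p, d_K, ℓ) = (7, -155, 251)`: the twist `E^{(-155)}` has rank two -/

/-- **Heegner data `d_K = -155` for `131a1`**: every prime of `Δ = -131` (hence of `N_E`) splits in a
quadratic field of discriminant `-155` (Kronecker symbols `= 1`). [cite: Marcus1977, Ch. 3 Thm. 25]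
[cite: GrossLMS1991, §1] -/
theorem heegner_neg155 : ∀ q : ℕ, q.Prime → (q : ℤ) ∣ (⟨0, -1, 1, 1, 0⟩ : WeierstrassCurve ℤ).Δ →
    (q = 2 → (-155 : ℤ) % 8 = 1) ∧ (q ≠ 2 → jacobiSym (-155) q = 1) :=
  forall_prime_dvd_of_natAbs_eq_pow (a := 131) (i := 1) (by decide +kernel) (by norm_num)
    ⟨by norm_num, by norm_num⟩

/-- The twist model of the kit `…RowKitSecondSign` for `(131a1, D = -155)`:
`[0, D b₂, 0, 8 D² b₄, 16 D³ b₆] = ⟨0, 620, 0, 384400, -59582000⟩` (`ℚ`-isomorphic to `E^{(-155)}`, `u = 1/2`).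
[cite: SilvermanAEC2009, X.5 Cor. 5.4] -/
theorem twistModel_neg155 :
    (⟨0, (-155) * (⟨0, -1, 1, 1, 0⟩ : WeierstrassCurve ℤ).b₂, 0, 8 * (-155) ^ 2 * (⟨0, -1, 1, 1, 0⟩ : WeierstrassCurve ℤ).b₄, 16 * (-155) ^ 3 * (⟨0, -1, 1, 1, 0⟩ : WeierstrassCurve ℤ).b₆⟩ : WeierstrassCurve ℤ) =
      ⟨0, 620, 0, 384400, -59582000⟩ := by
  ext <;> decide +kernel

/-- Killers for the twist model `⟨0, 620, 0, 384400, -59582000⟩` of `E^{(-155)}` from the kernel counts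
`(q, #Ṽ(𝔽_q)) ∈ [(3, 5), (7, 7)]`. [cite: SilvermanAEC2009, Prop. VII.3.1(b)] -/
theorem killers_neg155 : ∀ ℓN ∈ [((3 : ℕ), (5 : ℕ)), (7, 7)], ℓN.1.Prime ∧
    ∀ (x : ((⟨0, 620, 0, 384400, -59582000⟩ : WeierstrassCurve ℤ).map (Int.castRingHom ℚ)).toAffine.Point)
      (n : ℕ), ¬ ℓN.1 ∣ n → n • x = 0 → ℓN.2 • x = 0 :=
  killers_cons _ (q := 3) (N := 5) (by decide +kernel) (by decide +kernel)
    (killers_cons _ (q := 7) (N := 7) (by decide +kernel) (by decide +kernel)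
    (killers_nil _))

/-- **`2 ≤ rank_ℤ E^{(-155)}(ℚ)` for `E = 131a1` IN THE KERNEL**, on the twist model `⟨0, 620, 0, 384400, -59582000⟩`: rational
kernel certificate `Rank2Observatory.two_le_mordellWeilRank_of_ratCert` with the points
`P₁ = (1860, -96100)`, `P₂ = (206460/49, -101385500/343)` (found by a naive search on `d·η² = f(x)`), their chord
`P₁ + P₂ = (4420/9, -538100/27)`, odd torsion annihilator `t = 1` from the counts at `q = 3, 7`, and doubling
witnesses at `q = 11, 19, 11` (residues `(1,7)`, `(4,1)`, `(1,4)`). Hence `P₁, P₂` are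
`ℤ`-independent. [cite: SilvermanAEC2009, III.2.3, Prop. VII.3.1(b) and Thm. VIII.6.7]
[cite: CremonaAlgorithms1997, §3.5] -/
theorem two_le_rank_twist_neg155 :
    2 ≤ ((⟨0, 620, 0, 384400, -59582000⟩ : WeierstrassCurve ℤ).map (Int.castRingHom ℚ)).mordellWeilRank :=
  two_le_mordellWeilRank_of_ratCert _ (x₁ := 1860) (y₁ := -96100) (x₂ := 206460/49) (y₂ := -101385500/343)
    (x₃ := 4420/9) (y₃ := -538100/27) (by decide +kernel) (by decide +kernel)
    (by decide +kernel) (by decide +kernel) (t := 1) (by decide) killers_neg155 (by decide +kernel)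
    11 19 11 (by decide +kernel) (by decide +kernel) (by decide +kernel) (by decide +kernel)
    (by decide +kernel) (by decide +kernel) 1 7 4 1 1 4 (by decide +kernel)
    (by decide +kernel) (by decide +kernel) (by decide +kernel) (by decide +kernel)
    (by decide +kernel)

/-- **SECOND-SIGN DEPTH-TABLE ROW `131a1`, `(p, d_K, ℓ) = (7, -155, 251)`, ON PRINT-STANDARD INPUTS.**
For `E = 131a1` (rank one), ANY imaginary quadratic `K` with `d_K = -155` (Heegner for `N_E`; the twist
`E^{(-155)}` has two independent rational points, certified in the kernel), any frame `(Dt, β, ι)` and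
ANY single Kolyvagin–Heegner datum `d` of conductor `251` (a Kolyvagin prime: `(-155/251) = −1`,
`7 ∣ 251 + 1`, `7 ∣ a_251 = -28`), granted the ONE Literature fact (γ) =
`GrossLMS1991.prop37_2_frobeniusCongruence` (Gross 1991 Prop. 3.7 (2); cite-only): IF
`d.kolyvaginClass _ 1 ≠ 0` (the row's bit), THEN `corank_{ℤ_7} Ш(E)[7^∞] = 0`, `rank_ℤ E(ℚ) = 1`,
`corank_{ℤ_7} Ш(E^{(-155)})[7^∞] = 0`, `rank_ℤ E^{(-155)}(ℚ) = 2`, `E(ℚ)[7] = 0`, `Ш(E/ℚ)[7] = 0`,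
`#Sel^(7)(E/ℚ) = 7`, `Ш(E^{(-155)}/ℚ)[7] = 0` and `#Sel^(7)(E^{(-155)}/ℚ) = 7²` — the crux's SECOND
rank clause `ν = rank E(ℚ) = rank E^{(d_K)}(ℚ) − 1` at this curve, and `Ш[7] = 0` for the RANK-TWO
curve `E^{(-155)}` (conductor `N_E·155²`), which no first-sign row reaches through `K`. Side conditions:
`ρ̄_{E,7^m}` onto (`hasSurjectiveModNGaloisRep_pow_7`), non-CM, Heegner, Kolyvagin prime
(`card_251`), (KN_7) from `Δ(E₀) = -131` (`decide`-able table), `1 ≤ rank` (`one_le_rank`),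
`2 ≤ rank E^{(-155)}` (`two_le_rank_twist_neg155`) — all kernel theorems. CONDITIONAL on (γ) and the
bit; per-curve; BSD is not proved by it. [cite: Kolyvagin1991MathAnn, Thm. 2.3]
[cite: GrossLMS1991, Prop. 3.7 (2), §5 (5.1), Prop. 6.2 (1)] [cite: McCallumLMS1991, §§2–5]
[cite: JetchevLauterStein2009, §3.6 (arXiv:0707.0032)] -/
theorem depthRow_7_neg155_251_secondSign
    (h372 : GrossLMS1991.prop37_2_frobeniusCongruence)
    (K : Type) [Field K] [NumberField K] (hK : IsImaginaryQuadratic K)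
    (hD : NumberField.discr K = -155) :
    haveI := isElliptic;
    haveI := isGloballyMinimal;
    haveI : NeZero (((⟨0, -1, 1, 1, 0⟩ : WeierstrassCurve ℤ).map (Int.castRingHom ℚ)).conductorNorm ℤ) := neZero_conductorNorm_of_isElliptic _;
    ∀ (Dt : ModularParametrizationData ((⟨0, -1, 1, 1, 0⟩ : WeierstrassCurve ℤ).map (Int.castRingHom ℚ)) (((⟨0, -1, 1, 1, 0⟩ : WeierstrassCurve ℤ).map (Int.castRingHom ℚ)).conductorNorm ℤ)) (β : ℤ) (ι : K →+* ℂ)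
      (d : KolyvaginHeegnerData Dt β ι 251),
    d.kolyvaginClass (p := 7) (by norm_num) 1 ≠ 0 →
    ((⟨0, -1, 1, 1, 0⟩ : WeierstrassCurve ℤ).map (Int.castRingHom ℚ)).shaCorank 7 = 0 ∧ ((⟨0, -1, 1, 1, 0⟩ : WeierstrassCurve ℤ).map (Int.castRingHom ℚ)).mordellWeilRank = 1 ∧
      (((⟨0, -1, 1, 1, 0⟩ : WeierstrassCurve ℤ).map (Int.castRingHom ℚ)).quadraticTwist ((-155 : ℤ) : ℚ)).shaCorank 7 = 0 ∧
      (((⟨0, -1, 1, 1, 0⟩ : WeierstrassCurve ℤ).map (Int.castRingHom ℚ)).quadraticTwist ((-155 : ℤ) : ℚ)).mordellWeilRank = 2 ∧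
      (∀ P : ((⟨0, -1, 1, 1, 0⟩ : WeierstrassCurve ℤ).map (Int.castRingHom ℚ)).toAffine.Point, 7 • P = 0 → P = 0) ∧
      (∀ x ∈ ((⟨0, -1, 1, 1, 0⟩ : WeierstrassCurve ℤ).map (Int.castRingHom ℚ)).sha, 7 • x = 0 → x = 0) ∧
      Nat.card ↥(selmerGroup ((⟨0, -1, 1, 1, 0⟩ : WeierstrassCurve ℤ).map (Int.castRingHom ℚ)) ((7 : ℕ) : ℤ)) = 7 ∧
      (∀ x ∈ (((⟨0, -1, 1, 1, 0⟩ : WeierstrassCurve ℤ).map (Int.castRingHom ℚ)).quadraticTwist ((-155 : ℤ) : ℚ)).sha, 7 • x = 0 → x = 0) ∧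
      Nat.card ↥(selmerGroup (((⟨0, -1, 1, 1, 0⟩ : WeierstrassCurve ℤ).map (Int.castRingHom ℚ)).quadraticTwist ((-155 : ℤ) : ℚ)) ((7 : ℕ) : ℤ)) = 7 ^ 2 := by
  haveI := isElliptic
  haveI := isGloballyMinimal
  haveI : NeZero (((⟨0, -1, 1, 1, 0⟩ : WeierstrassCurve ℤ).map (Int.castRingHom ℚ)).conductorNorm ℤ) := neZero_conductorNorm_of_isElliptic _
  intro Dt β ι d hne
  haveI := Fact.mk (by norm_num : Nat.Prime 7)
  exact depthRowSecondSign_print_of_datum_of_intModel_certificate intModel h372 not_hasCM one_le_rank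
    7 (by norm_num) hasSurjectiveModNGaloisRep_pow_7 K hK hD (by norm_num) (by norm_num)
    twistModel_neg155 two_le_rank_twist_neg155 heegner_neg155 251 (by norm_num) (by norm_num)
    (by decide +kernel) (by norm_num) (by norm_num) (by norm_num) (by norm_num) (n := 280) card_251
    (by norm_num) (Δ₀ := -131) (by decide +kernel) (B := 11) (by decide +kernel) (by decide +kernel)
    (fun _ _ ↦ Or.inl (by norm_num)) Dt β ι d hne

end C131a1


end SecondSign

end Summit.BirchSwinnertonDyer.BirchSwinnertonDyer.Theorems.KolyvaginDepthDoor

end
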